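import Summits.QuantumFields.YangMills.Theorems.UnitScaleTiltProp7LandauTransversalityRowsY1
import Summits.QuantumFields.YangMills.Theorems.UnitScaleTiltProp7FrameRowsOfPlaqSmall
import Summits.QuantumFields.YangMills.Theorems.UnitScaleTiltProp7SliceOntoOfPlaqSmall
import HarnessLib

/-!
# Route `UnitScaleTilt`, crux K1 child «MinimiserStabilityRegPr» (stmt-QuantumFields-19200), skeleton v10, stub `stub_existenceMinimalOrbit` (EX), route (α) —
# **«Y1-ALL»: ✓`Prop7LandauTransversalityRowsY1.exists_rowsY1` (★w5-20520 g7 ✓p670203, «(P2)-KNIT-Y1») FOR EVERY MEMBER OF THE FAMILY** — the same three (Y, 𝓚, q)-rows `hT`, `hQ4`, `hKT`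
# with `C₀·δ ≤ 1∕10`, the fat-bump ROOM `100·η ≤ 1` (⇔ `L^{K−n} ≥ 100`, violated by the coarsest members) REPLACED by `3·η ≤ 1` — true at EVERY member `(F, n < K)` of `Idx L` (`η = (L⁻¹)^{K−n} ≤ 1∕3`,
# ✓`three_le_memberL`) — at the price of two TIGHTER L-only windows `10¹⁵·L²·e ≤ 1`, `10¹⁸·L³·ε₀ ≤ 1` (numerals; the EX census re-inhabits them).  PROOF = ✓p670203's, constant for constant, with:
# fat bump at `w := 1∕12` (`κ ≥ (1 − 1∕6 − 2∕3)³ = 6⁻³` instead of `(39∕50)³`), `s₁ := 31` (instead of `26`), smoothing `t := 1∕(2·16200²)` (`√(t∕2) = 1∕32400`, `√(2t) = 1∕16200`; free in ✓`hQ4_of_rows`)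
# instead of `1∕11250`, `δ := √2·3∕10¹⁰` from `deltaT_le_tighter` (instead of `√2·3∕10⁶`); window arithmetic `κ(1 − θ) ≥ 1∕320`, `C₀ ≤ 502232.5·320`, `C₀·δ ≤ 0.073` = `window_numerics_all`.
# Inputs consumed BY NAME, generic in these constants (✓`exists_fatBlockBumpExtension` in `w`, ✓`hQ4_of_rows` in `κ θ₀ s₀ s₁ C_𝓚 t`, frame-response rows in `δ_T`); `U′` enters through its PLAQUETTE regularity only (FILE A∕B, cure (C1′)).

Cell `ym3-torus`, width seat `ym3-torus-px16` (gen 4).  THEOREMS ONLY (0 `def`, 0 `sorry`).  `--supports stmt-QuantumFields-19200 --as helper`, count-neutral.  YM₃ on T³ is a ladder rung (R3), not the Clay problem; nothing here claims the stub, the crux, d = 4 or the mass gap.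

References: T. Bałaban, CMP 99 (1985) 389–434 [Balaban1985BackgroundPropagators] ((3.8) p.392, (3.19)–(3.23) pp.393–394, (3.114)–(3.115) p.418); CMP 102 (1985) 277–309 [Balaban1985Variational] ((2) p.278, (45) p.285, (82)–(83) p.290); CMP 98 (1985) 17–51 [Balaban1985Averaging] ((97) p.32, (161)–(163) p.42).
-/

set_option autoImplicit false

noncomputable section

open scoped BigOperators InnerProductSpace Matrix.Norms.L2Operator ComplexConjugate

namespace Summit.QuantumFields.YangMills.Theorems.Prop7LandauTransversalityRowsY1All

open Literature.MathematicalPhysics.QuantumFieldTheory.Balaban1983to89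
open Literature.MathematicalPhysics.QuantumFieldTheory.Balaban1983to89.T3ContinuumYM3Torus
open T4Continuum BlockAveraging
open B10Eq27TorusAxialLog (holT gaugeActT transl unitsField toUField axialT)
open B7Prop1Explicit (expUnit val_expUnit disp U1 mem_U1)
open B7TransferAnalyticMean (meanCLM)
open B7Eq78Linearization (conjR)
open B5Eq118OneStroke (iterBlockOf iterBlock mem_iterBlock)
open B15DeterminingSets (embIter)
open T3LevelShift (siteShift)
open T3PrintedRegularOrbits (sites_eq)
open T3RegularMinimiser (regThreshold)
open T3PrintedRegularMinimiser (RegPr)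
open T3SectALandauChart (eta eta_pos bgUnits)
open Literature.Analysis.Calculus.ExpDifferential (ad gSer)
open NormedSpace (exp)
open B11Eq103H1Complex (SiteL2K BondL2K)
open Summit.QuantumFields.YangMills.Theorems.Prop7SectET3Transport (periodsT3)
open Summit.QuantumFields.YangMills.Theorems.Prop7SectET3HilbertLetters (W₂ toL2 toL2S DL2 DstarL2 covLapSite)
open Summit.QuantumFields.YangMills.Theorems.Prop7SectET3GaugeProjector (NS)
open Summit.QuantumFields.YangMills.Theorems.Prop7SymAvgTwSym (frameAccU logChartTwS pow_mul_eta_eq_one regThreshold_eq_mul_eta_sq)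
open Summit.QuantumFields.YangMills.Theorems.Prop8Chart (emlIterU)
open Summit.QuantumFields.YangMills.Theorems.Prop7SliceOntoOfPlaqSmall (fderiv_logChartTwS_eq_zero_of_frameCorrected_eq_zero_of_plaqSmall)
open Summit.QuantumFields.YangMills.Theorems.Prop7FrameCorrectedMinusMean (crs_frameResponse_sub_avgSeq_le_of_plaqSmall crs_avgSeq_le_of_regPr normSq_toL2S_shift_eq
  norm_toL2S_shift_frameResponse_le_of_plaqSmall_of_avgSeq_eq_zero exists_linear_frameResponse_of_plaqSmall)
open Summit.QuantumFields.YangMills.Theorems.Prop7NestedMeanTowerCloseness (norm_ns_sub_refMean_le_of_plaqSmall norm_axialGauge_bond_sub_one_le_T3)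
open Summit.QuantumFields.YangMills.Theorems.Prop7BlockBumpExtension (exists_fatBlockBumpExtension)
open Summit.QuantumFields.YangMills.Theorems.Prop7ResolventSmoothing (hQ4_of_rows)
open Summit.QuantumFields.YangMills.Theorems.Prop7CovMeanTowerOnto (exists_avgSeq)
open Summit.QuantumFields.YangMills.Theorems.Prop7CovariantCoercivity (sum_norm_sq_le_mul_opNorm_sq)

open Summit.QuantumFields.YangMills.Theorems.Prop7LandauTransversalityRowsY1 (exists_Kop_linear)

variable (F : T3Family) {n K : ℕ} (h : n ≤ K)

/-! ## §1 The tighter `δ_T` window and the all-members window arithmetic -/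

/-- **THE LETTER `δ_T` UNDER THE ALL-MEMBERS WINDOWS**: with `10¹⁵L²e ≤ 1`, `10¹⁸L³ε₀ ≤ 1`, `L ≥ 3`: `2·(240L + 19560L³)·c∕(L − 1) ≤ 3∕10¹⁰` (`c = 2e + 2700Lε₀`; same proof as
✓`deltaT_le_tight`, every scale ×10⁻⁴). [cite: Balaban1985Variational, (2) p.278; Balaban1985Averaging, (161)-(163) p.42] -/
theorem deltaT_le_tighter {ε₀ e : ℝ} (hε₀ : 0 < ε₀) (he : 0 ≤ e) (hWe : 10 ^ 15 * (F.L : ℝ) ^ 2 * e ≤ 1) (hWε : 10 ^ 18 * (F.L : ℝ) ^ 3 * ε₀ ≤ 1) :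
    2 * (240 * (F.L : ℝ) + 19560 * (F.L : ℝ) ^ 3) * (2 * e + 2700 * (F.L : ℝ) * ε₀) / ((F.L : ℝ) - 1) ≤ 3 / 10 ^ 10 := by
  have hL3 : 3 ≤ F.L := by obtain ⟨a, ha⟩ := F.hL.1; have := F.hL.2; omega
  have hL3r : (3 : ℝ) ≤ F.L := by exact_mod_cast hL3
  have hL1 : (0 : ℝ) < (F.L : ℝ) - 1 := by linarith
  rw [div_le_iff₀ hL1]
  have hu : (F.L : ℝ) ^ 2 * e ≤ 1 / 10 ^ 15 := by rw [le_div_iff₀ (by positivity)]; linarith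
  have hv : (F.L : ℝ) ^ 3 * ε₀ ≤ 1 / 10 ^ 18 := by rw [le_div_iff₀ (by positivity)]; linarith
  have h1 : (F.L : ℝ) * e ≤ 1 / 10 ^ 15 / 3 := by
    have : 3 * ((F.L : ℝ) * e) ≤ (F.L : ℝ) ^ 2 * e := by
      calc 3 * ((F.L : ℝ) * e) ≤ (F.L : ℝ) * ((F.L : ℝ) * e) := mul_le_mul_of_nonneg_right hL3r (by positivity)
        _ = (F.L : ℝ) ^ 2 * e := by ring
    linarith
  have h2 : (F.L : ℝ) ^ 2 * ε₀ ≤ 1 / 10 ^ 18 / 3 := by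
    have : 3 * ((F.L : ℝ) ^ 2 * ε₀) ≤ (F.L : ℝ) ^ 3 * ε₀ := by
      calc 3 * ((F.L : ℝ) ^ 2 * ε₀) ≤ (F.L : ℝ) * ((F.L : ℝ) ^ 2 * ε₀) := mul_le_mul_of_nonneg_right hL3r (by positivity)
        _ = (F.L : ℝ) ^ 3 * ε₀ := by ring
    linarith
  have h3 : (F.L : ℝ) ^ 3 * e ≤ (F.L : ℝ) * (1 / 10 ^ 15) := by
    have : (F.L : ℝ) ^ 3 * e = (F.L : ℝ) * ((F.L : ℝ) ^ 2 * e) := by ring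
    rw [this]; exact mul_le_mul_of_nonneg_left hu (by positivity)
  have h4 : (F.L : ℝ) ^ 4 * ε₀ ≤ (F.L : ℝ) * (1 / 10 ^ 18) := by
    have : (F.L : ℝ) ^ 4 * ε₀ = (F.L : ℝ) * ((F.L : ℝ) ^ 3 * ε₀) := by ring
    rw [this]; exact mul_le_mul_of_nonneg_left hv (by positivity)
  have hexp : 2 * (240 * (F.L : ℝ) + 19560 * (F.L : ℝ) ^ 3) * (2 * e + 2700 * (F.L : ℝ) * ε₀)
      = 960 * ((F.L : ℝ) * e) + 1296000 * ((F.L : ℝ) ^ 2 * ε₀) + 78240 * ((F.L : ℝ) ^ 3 * e) + 105624000 * ((F.L : ℝ) ^ 4 * ε₀) := by ring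
  rw [hexp]
  nlinarith

/-- **THE ALL-MEMBERS WINDOW ARITHMETIC** (all letters bounded by rationals): with `κ ≥ 6⁻³`, `θ₀κ ≤ 10⁻⁵`, `C_𝓚 ≤ 3∕2`, `s₀ = 3∕2`, `s₁ = 31`, `√(t∕2) = 1∕32400`, `√(2t) = 1∕16200`,
`δ = √2·3∕10¹⁰`: `θ := θ₀ + C_𝓚·(1∕32400)·31∕κ < 1`, `κ(1 − θ) ≥ 1∕320`, and `C₀·δ ≤ 1∕10` for `C₀ := (s₀ + s₁ + s₁∕(1∕16200))∕(κ(1 − θ))`. [folklore] -/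
theorem window_numerics_all {κ θ₀ CK : ℝ} (hκ : (1 / 6 : ℝ) ^ 3 ≤ κ) (hθ₀' : θ₀ * κ ≤ 1 / 10 ^ 5) (hCK : CK ≤ 3 / 2) :
    θ₀ + CK * ((1 / 32400 : ℝ) * 31) / κ < 1 ∧
      0 ≤ (3 / 2 + 31 + 31 / (1 / 16200 : ℝ)) / (κ * (1 - (θ₀ + CK * ((1 / 32400 : ℝ) * 31) / κ))) ∧
      (3 / 2 + 31 + 31 / (1 / 16200 : ℝ)) / (κ * (1 - (θ₀ + CK * ((1 / 32400 : ℝ) * 31) / κ))) * (Real.sqrt 2 * (3 / 10 ^ 10)) ≤ 1 / 10 := by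
  have hκ0 : 0 < κ := lt_of_lt_of_le (by norm_num) hκ
  have hκv : (1 / 216 : ℝ) ≤ κ := le_trans (by norm_num) hκ
  -- `κ(1 − θ) = κ − θ₀κ − C_𝓚·31∕32400 ≥ 1∕320`
  have hden : κ * (1 - (θ₀ + CK * ((1 / 32400 : ℝ) * 31) / κ)) = κ - θ₀ * κ - CK * (31 / 32400) := by
    field_simp
    ring
  have hden5 : (1 / 320 : ℝ) ≤ κ * (1 - (θ₀ + CK * ((1 / 32400 : ℝ) * 31) / κ)) := by
    rw [hden]; nlinarith
  have hdenpos : 0 < κ * (1 - (θ₀ + CK * ((1 / 32400 : ℝ) * 31) / κ)) := lt_of_lt_of_le (by norm_num) hden5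
  refine ⟨?_, ?_, ?_⟩
  · -- `θ < 1` from `κ(1 − θ) > 0`
    by_contra hθ
    rw [not_lt] at hθ
    have : κ * (1 - (θ₀ + CK * ((1 / 32400 : ℝ) * 31) / κ)) ≤ 0 := mul_nonpos_of_nonneg_of_nonpos hκ0.le (by linarith)
    linarith
  · exact div_nonneg (by norm_num) hdenpos.le
  · have hnum : (3 / 2 + 31 + 31 / (1 / 16200 : ℝ)) = 1004465 / 2 := by norm_num
    rw [hnum]
    have hs2 : Real.sqrt 2 ≤ 3 / 2 := by
      have h1 : Real.sqrt 2 ≤ Real.sqrt ((3 / 2) ^ 2) := Real.sqrt_le_sqrt (by norm_num)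
      rwa [Real.sqrt_sq (by norm_num)] at h1
    have hC₀ : (1004465 / 2 : ℝ) / (κ * (1 - (θ₀ + CK * ((1 / 32400 : ℝ) * 31) / κ))) ≤ (1004465 / 2) / (1 / 320) :=
      div_le_div_of_nonneg_left (by norm_num) (by norm_num) hden5
    calc (1004465 / 2 : ℝ) / (κ * (1 - (θ₀ + CK * ((1 / 32400 : ℝ) * 31) / κ))) * (Real.sqrt 2 * (3 / 10 ^ 10))
        ≤ (1004465 / 2) / (1 / 320) * ((3 / 2) * (3 / 10 ^ 10)) := by
          refine mul_le_mul hC₀ (mul_le_mul_of_nonneg_right hs2 (by norm_num)) (by positivity) (by norm_num)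
      _ ≤ 1 / 10 := by norm_num

/-! ## §2 The three currency rows at (Y1′), all members -/

set_option maxHeartbeats 400000 in
/-- ★★★ **«Y1-ALL» — ✓`exists_rowsY1` FOR EVERY MEMBER: THE THREE (Y, 𝓚, q)-ROWS OF ✓`htest_of_rows` ∕ ✓`hSplitD_of_rows` AT THE COARSE CURRENCY OF RECORD.**  For a chart point `U′ = e^{A₁}U₀` (`RegPr ε₀ U₀`,
`PlaqSmall (regThreshold ε₀′) U′` — the PLAQUETTE half only, px16 g4 (C1′), `‖A₁‖ < eη`) under the windows of record, the two ALL-MEMBERS windows `10¹⁵L²e ≤ 1`, `10¹⁸L³ε₀ ≤ 1` and the member bound `3η ≤ 1` (every member: `L ≥ 3`, `n < K`), with ROW-V's ℂ-linear response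
letter `V` (✓`exists_linear_frameResponse_of_regPr`) obtained inside: there are a ℂ-linear `𝓚` (T5-A's frame-corrected gauge operator, `𝓚 N y = N(x̂⁽ᵏ⁾y) − V N y·ν_k(y)⁻¹`) and constants `C₀, δ ≥ 0` with `C₀·δ ≤ 1∕10` such that,
with `q c := ‖toL2S F n c₁ (c ∘ siteShift)‖` (`c₁ = c₀η⁻³`): (T) `M w = Gd N′ ∧ 𝓚 N′ = 0 ⟹ fderiv logChartTwS A₁ w = 0`; (Q4-H²) `∀ m, ∃ N, 𝓚 N = m ∧ ‖toL2S N‖, ‖D_{U₀}(toL2S N)‖, ‖Δ^η_{U₀}(toL2S N)‖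
≤ C₀·q m`; (T-small) on the sector «nested mean ends at 0»: `q(𝓚 l₁) ≤ δ·(‖toL2S l₁‖ + ‖D_{U₀}(toL2S l₁)‖)`.  [cite: Balaban1985BackgroundPropagators, (3.19)–(3.23) pp.393–394, (3.114)–(3.115)
p.418; Balaban1985Variational, (45) p.285, (82)–(83) p.290; Balaban1985Averaging, (97) p.32] -/
theorem exists_rowsY1_all {c₀ c₁ : ℝ} [Fact (0 < c₀)] [Fact (0 < c₁)] (hc₁ : c₁ = c₀ * (eta F n K)⁻¹ ^ 3) (cB : ℝ)
    {ε₀ ε₀' e : ℝ} (hε₀ : 0 < ε₀) (he : 0 < e) (hWe : 10 ^ 9 * (F.L : ℝ) ^ 2 * e ≤ 1) (hWε : 10 ^ 12 * (F.L : ℝ) ^ 3 * ε₀ ≤ 1)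
    (hWe' : 10 ^ 15 * (F.L : ℝ) ^ 2 * e ≤ 1) (hWε' : 10 ^ 18 * (F.L : ℝ) ^ 3 * ε₀ ≤ 1) (hε₀' : 0 < ε₀') (hε' : 10 ^ 7 * (F.L : ℝ) ^ 3 * ε₀' ≤ 1)
    (hη : 3 * eta F n K ≤ 1)
    (U₀ U' : GaugeField (F.P K) 0 (Matrix.specialUnitaryGroup (Fin 2) ℂ)) (hreg : RegPr F n K ε₀ U₀) (hplaq' : PlaqSmall (regThreshold F n K ε₀') U')
    (A₁ : PBond (F.P K) 0 → Matrix (Fin 2) (Fin 2) ℂ) (hA₁ : ‖A₁‖ < e * eta F n K)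
    (hU' : ∀ b, ((U' b : Matrix.specialUnitaryGroup (Fin 2) ℂ) : Matrix (Fin 2) (Fin 2) ℂ) = exp (A₁ b) * ((U₀ b : Matrix.specialUnitaryGroup (Fin 2) ℂ) : Matrix (Fin 2) (Fin 2) ℂ)) :
    ∃ (Kop : (Site (F.P K) 0 → Matrix (Fin 2) (Fin 2) ℂ) →ₗ[ℂ] (Site (F.P K) (K - n) → Matrix (Fin 2) (Fin 2) ℂ)) (C₀ δ : ℝ),
      0 ≤ C₀ ∧ 0 ≤ δ ∧ C₀ * δ ≤ 1 / 10 ∧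
      (∀ (N' : Site (F.P K) 0 → Matrix (Fin 2) (Fin 2) ℂ) (w : PBond (F.P K) 0 → Matrix (Fin 2) (Fin 2) ℂ),
        (∀ b, gSer ℂ (ad ℂ (-A₁ b)) (w b) = N' b.src - ((bgUnits F K U' b : (Matrix (Fin 2) (Fin 2) ℂ)ˣ) : Matrix (Fin 2) (Fin 2) ℂ) * N' b.tgt *
          (((bgUnits F K U' b)⁻¹ : (Matrix (Fin 2) (Fin 2) ℂ)ˣ) : Matrix (Fin 2) (Fin 2) ℂ)) →
        Kop N' = 0 → fderiv ℂ (logChartTwS F n K h U₀) A₁ w = 0) ∧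
      (∀ m : Site (F.P K) (K - n) → Matrix (Fin 2) (Fin 2) ℂ, ∃ N : Site (F.P K) 0 → Matrix (Fin 2) (Fin 2) ℂ, Kop N = m ∧
        ‖toL2S F K c₀ N‖ ≤ C₀ * ‖toL2S F n c₁ (fun y' : Site (F.P n) 0 => m (siteShift (sites_eq F n K h) y'))‖ ∧
        ‖DL2 F n K c₀ U₀ (toL2S F K c₀ N)‖ ≤ C₀ * ‖toL2S F n c₁ (fun y' : Site (F.P n) 0 => m (siteShift (sites_eq F n K h) y'))‖ ∧
        ‖covLapSite F n K c₀ U₀ (toL2S F K c₀ N)‖ ≤ C₀ * ‖toL2S F n c₁ (fun y' : Site (F.P n) 0 => m (siteShift (sites_eq F n K h) y'))‖) ∧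
      (∀ l₁ : Site (F.P K) 0 → Matrix (Fin 2) (Fin 2) ℂ, toL2S F K c₀ l₁ ∈ NS F n K h c₀ cB U₀ →
        (∃ ns : (j : ℕ) → Site (F.P K) j → Matrix (Fin 2) (Fin 2) ℂ, ns 0 = l₁ ∧
          (∀ (j : ℕ) (y : Site (F.P K) (j + 1)), ns (j + 1) y = ns j (emb y) - meanCLM (Idx (F.P K)) (Matrix (Fin 2) (Fin 2) ℂ) fun i : Idx (F.P K) =>
            ns j (emb y) - ((holT (emlIterU j (bgUnits F K U₀)) (emb y) (stairWord i.2.1 (off i.1)) : (Matrix (Fin 2) (Fin 2) ℂ)ˣ) : Matrix (Fin 2) (Fin 2) ℂ) *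
              ns j (transl (emb y) (disp (stairWord i.2.1 (off i.1)))) * (((holT (emlIterU j (bgUnits F K U₀)) (emb y) (stairWord i.2.1 (off i.1)))⁻¹ : (Matrix (Fin 2) (Fin 2) ℂ)ˣ) : Matrix (Fin 2) (Fin 2) ℂ)) ∧
          ∀ y, ns (K - n) y = 0) →
        ‖toL2S F n c₁ (fun y' : Site (F.P n) 0 => Kop l₁ (siteShift (sites_eq F n K h) y'))‖ ≤ δ * (‖toL2S F K c₀ l₁‖ + ‖DL2 F n K c₀ U₀ (toL2S F K c₀ l₁)‖)) := by
  have hη0 : 0 < eta F n K := eta_pos F n K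
  have hηle : eta F n K ≤ 1 / 3 := by linarith
  have hsq2 : Real.sqrt 2 ≤ 3 / 2 := by
    have h1 : Real.sqrt 2 ≤ Real.sqrt ((3 / 2) ^ 2) := Real.sqrt_le_sqrt (by norm_num)
    rwa [Real.sqrt_sq (by norm_num)] at h1
  have hsq6 : Real.sqrt 6 ≤ 5 / 2 := by
    have h1 : Real.sqrt 6 ≤ Real.sqrt ((5 / 2) ^ 2) := Real.sqrt_le_sqrt (by norm_num)
    rwa [Real.sqrt_sq (by norm_num)] at h1
  have hL1 : (1 : ℝ) ≤ F.L := by have := F.hL.2; exact_mod_cast (show 1 ≤ F.L by omega)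
  have hpow : (F.L : ℝ) ^ (K - n) * eta F n K = 1 := pow_mul_eta_eq_one F
  -- ROW-V (★px6 g2): the ℂ-linear response letter `V`
  obtain ⟨V, hV⟩ := exists_linear_frameResponse_of_plaqSmall F hε₀ he hWe hWε hε₀' hε' U₀ U' hreg hplaq' A₁ hA₁ hU'
  obtain ⟨Kop, hKop⟩ := exists_Kop_linear F (n := n) U₀ U' V
  -- the curves `t ↦ exp(tN)` and their derivative rows
  have hg0 : ∀ N : Site (F.P K) 0 → Matrix (Fin 2) (Fin 2) ℂ, (fun t : ℝ => fun z : Site (F.P K) 0 => expUnit (t • N z)) 0 = fun _ => 1 := fun N => by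
    funext z; apply Units.ext; rw [val_expUnit, zero_smul, NormedSpace.exp_zero, Units.val_one]
  have hgd : ∀ (N : Site (F.P K) 0 → Matrix (Fin 2) (Fin 2) ℂ) (z : Site (F.P K) 0),
      HasDerivAt (fun t : ℝ => (((fun t : ℝ => fun z : Site (F.P K) 0 => expUnit (t • N z)) t z : (Matrix (Fin 2) (Fin 2) ℂ)ˣ) : Matrix (Fin 2) (Fin 2) ℂ)) (N z) 0 := fun N z => by
    have h1 := hasDerivAt_exp_smul_const' (𝕂 := ℝ) (N z) (0 : ℝ)
    simp only [zero_smul, NormedSpace.exp_zero, mul_one] at h1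
    have hfun : (fun t : ℝ => (((fun t : ℝ => fun z : Site (F.P K) 0 => expUnit (t • N z)) t z : (Matrix (Fin 2) (Fin 2) ℂ)ˣ) : Matrix (Fin 2) (Fin 2) ℂ)) = fun t => exp (t • N z) := by
      funext t; exact val_expUnit _
    rw [hfun]; exact h1
  -- the transporter tower of the background and its averaging sequences
  set T : (j : ℕ) → Site (F.P K) (j + 1) → Idx (F.P K) → (Matrix (Fin 2) (Fin 2) ℂ)ˣ :=
    fun j y i => holT (emlIterU j (bgUnits F K U₀)) (emb y) (stairWord i.2.1 (off i.1)) with hTdef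
  -- `δT := 3/10⁶` under the tighter windows
  have hδT : 2 * (240 * (F.L : ℝ) + 19560 * (F.L : ℝ) ^ 3) * (2 * e + 2700 * (F.L : ℝ) * ε₀) / ((F.L : ℝ) - 1) ≤ 3 / 10 ^ 10 :=
    deltaT_le_tighter F hε₀ he.le hWe' hWε'
  -- the coarse size `q` and its gauge axioms
  set Φ : (Site (F.P K) (K - n) → Matrix (Fin 2) (Fin 2) ℂ) →ₗ[ℂ] SiteL2K ℂ 3 (periodsT3 F n) c₁ W₂ :=
    (toL2S F n c₁ : (Site (F.P n) 0 → Matrix (Fin 2) (Fin 2) ℂ) ≃ₗ[ℂ] SiteL2K ℂ 3 (periodsT3 F n) c₁ W₂).toLinearMap ∘ₗ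
      LinearMap.funLeft ℂ (Matrix (Fin 2) (Fin 2) ℂ) (siteShift (sites_eq F n K h)) with hΦdef
  have hΦapp : ∀ m, Φ m = toL2S F n c₁ (fun y' : Site (F.P n) 0 => m (siteShift (sites_eq F n K h) y')) := fun m => rfl
  set q : (Site (F.P K) (K - n) → Matrix (Fin 2) (Fin 2) ℂ) → ℝ := fun m => ‖Φ m‖ with hqdef
  have hq_add : ∀ a b, q (a + b) ≤ q a + q b := fun a b => by simp only [hqdef, map_add]; exact norm_add_le _ _
  have hq_smul : ∀ (r : ℝ) (a : Site (F.P K) (K - n) → Matrix (Fin 2) (Fin 2) ℂ), q (((r : ℝ) : ℂ) • a) = |r| * q a := fun r a => by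
    simp only [hqdef, map_smul, norm_smul, Complex.norm_real, Real.norm_eq_abs]
  have hq_def : ∀ a, q a = 0 → a = 0 := fun a ha => by
    have h1 : Φ a = 0 := norm_eq_zero.1 ha
    have h2 : LinearMap.funLeft ℂ (Matrix (Fin 2) (Fin 2) ℂ) (siteShift (sites_eq F n K h)) a = 0 := by
      have := h1; rw [hΦdef, LinearMap.comp_apply] at this
      exact (LinearEquiv.map_eq_zero_iff _).1 this
    exact LinearMap.funLeft_injective_of_surjective ℂ _ _ (siteShift (sites_eq F n K h)).surjective (h2.trans (map_zero _).symm)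
  have hq_nonneg : ∀ a, 0 ≤ q a := fun a => norm_nonneg _
  -- `q m = √(c₀η⁻³ Σ_y Σ_jk |m y j k|²)`
  have hq_eq : ∀ m, q m = Real.sqrt (c₀ * (eta F n K)⁻¹ ^ 3 * ∑ y : Site (F.P K) (K - n), ∑ j : Fin 2, ∑ k : Fin 2, ‖m y j k‖ ^ 2) := fun m => by
    show ‖Φ m‖ = _
    rw [hΦapp, ← Real.sqrt_sq (norm_nonneg (toL2S F n c₁ _)), normSq_toL2S_shift_eq F h, hc₁]
  have hε7 : 10 ^ 7 * (F.L : ℝ) ^ 3 * ε₀ ≤ 1 := by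
    have : 0 ≤ (F.L : ℝ) ^ 3 * ε₀ := by positivity
    nlinarith
  /- (T) the kernel row (★px10 g2 ROW-G) -/
  have HT : ∀ (N' : Site (F.P K) 0 → Matrix (Fin 2) (Fin 2) ℂ) (w : PBond (F.P K) 0 → Matrix (Fin 2) (Fin 2) ℂ),
      (∀ b, gSer ℂ (ad ℂ (-A₁ b)) (w b) = N' b.src - ((bgUnits F K U' b : (Matrix (Fin 2) (Fin 2) ℂ)ˣ) : Matrix (Fin 2) (Fin 2) ℂ) * N' b.tgt *
        (((bgUnits F K U' b)⁻¹ : (Matrix (Fin 2) (Fin 2) ℂ)ˣ) : Matrix (Fin 2) (Fin 2) ℂ)) →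
      Kop N' = 0 → fderiv ℂ (logChartTwS F n K h U₀) A₁ w = 0 := by
    intro N' w hw hK0
    refine fderiv_logChartTwS_eq_zero_of_frameCorrected_eq_zero_of_plaqSmall F h hε₀ he hWe hWε hε₀' hε' U₀ U' hreg hplaq' A₁ hA₁ hU' N' (V N') (hV N') (fun x => ?_) w hw
    have h1 := congr_fun hK0 x
    rw [hKop] at h1
    exact h1
  /- (T-small) the transfer row on the sector (★px6 g2 R2t) -/
  have HKT : ∀ l₁ : Site (F.P K) 0 → Matrix (Fin 2) (Fin 2) ℂ, toL2S F K c₀ l₁ ∈ NS F n K h c₀ cB U₀ →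
      (∃ ns : (j : ℕ) → Site (F.P K) j → Matrix (Fin 2) (Fin 2) ℂ, ns 0 = l₁ ∧
        (∀ (j : ℕ) (y : Site (F.P K) (j + 1)), ns (j + 1) y = ns j (emb y) - meanCLM (Idx (F.P K)) (Matrix (Fin 2) (Fin 2) ℂ) fun i : Idx (F.P K) =>
          ns j (emb y) - ((holT (emlIterU j (bgUnits F K U₀)) (emb y) (stairWord i.2.1 (off i.1)) : (Matrix (Fin 2) (Fin 2) ℂ)ˣ) : Matrix (Fin 2) (Fin 2) ℂ) *
            ns j (transl (emb y) (disp (stairWord i.2.1 (off i.1)))) * (((holT (emlIterU j (bgUnits F K U₀)) (emb y) (stairWord i.2.1 (off i.1)))⁻¹ : (Matrix (Fin 2) (Fin 2) ℂ)ˣ) : Matrix (Fin 2) (Fin 2) ℂ)) ∧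
        ∀ y, ns (K - n) y = 0) →
      ‖toL2S F n c₁ (fun y' : Site (F.P n) 0 => Kop l₁ (siteShift (sites_eq F n K h) y'))‖
        ≤ Real.sqrt 2 * (3 / 10 ^ 10) * (‖toL2S F K c₀ l₁‖ + ‖DL2 F n K c₀ U₀ (toL2S F K c₀ l₁)‖) := by
    intro l₁ _ hZ
    obtain ⟨ns, h0, hsucc, hz⟩ := hZ
    have hmain := norm_toL2S_shift_frameResponse_le_of_plaqSmall_of_avgSeq_eq_zero F h hε₀ he hWe hWε hε₀' hε' U₀ U' hreg hplaq' A₁ hA₁ hU'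
      (hg0 l₁) (hgd l₁) ns h0 hsucc hz (hV l₁) hδT hc₁
    have hfun : (fun y' : Site (F.P n) 0 => Kop l₁ (siteShift (sites_eq F n K h) y')) = fun y' : Site (F.P n) 0 =>
        l₁ (embIter (K - n) (siteShift (sites_eq F n K h) y')) - V l₁ (siteShift (sites_eq F n K h) y') *
          (((frameAccU (K - n) (bgUnits F K U₀) (bgUnits F K U') (siteShift (sites_eq F n K h) y'))⁻¹ : (Matrix (Fin 2) (Fin 2) ℂ)ˣ) : Matrix (Fin 2) (Fin 2) ℂ) :=
      funext fun y' => hKop l₁ _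
    rw [hfun]
    exact hmain
  /- (Q4-H²): the fat framed bump (★px10 g2) on ★px11 g2's corner-axial frame -/
  have hsb0 : 0 ≤ 2 * ((3 : ℝ) * ((F.L : ℝ) ^ (K - n) - 1)) * regThreshold F n K ε₀ := by
    have h1 : (1 : ℝ) ≤ (F.L : ℝ) ^ (K - n) := one_le_pow₀ hL1
    have h2 : 0 ≤ regThreshold F n K ε₀ := by rw [regThreshold_eq_mul_eta_sq]; positivity
    have h3 : (0 : ℝ) ≤ (F.L : ℝ) ^ (K - n) - 1 := by linarith
    positivity
  obtain ⟨S, χ, κ, hSf, hS0, hS1, hχ01, hχsh, hχun, hχlip, hi, hii, hiii, hκlo, hκhi⟩ :=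
    exists_fatBlockBumpExtension F h hc₁ U₀ (fun Y : Site (F.P K) (K - n) => Site.fibreSite 0 (K - n) Y fun _ => (⟨0, pow_pos (F.P K).L_pos (K - n)⟩ : Fin ((F.P K).L ^ (K - n))))
      (w := 1 / 12) (by norm_num) (by linarith) hsb0 (fun Y b hb hb' => norm_axialGauge_bond_sub_one_le_T3 F hε₀ U₀ hreg.1 Y b hb hb')
  have hκlo' : (1 / 6 : ℝ) ^ 3 ≤ κ := by
    have h1 : (1 / 6 : ℝ) ≤ 1 - 2 * (1 / 12) - 2 * eta F n K := by linarith
    exact le_trans (pow_le_pow_left₀ (by norm_num) h1 3) hκlo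
  have hκ0 : 0 < κ := lt_of_lt_of_le (by norm_num) hκlo'
  -- (H⁰), (H¹) with rational constants `s₀ = 3/2`, `s₁ = 31`
  have HS0 : ∀ c, ‖toL2S F K c₀ (S c)‖ ≤ (3 / 2) * q c := fun c =>
    (hS0 c).trans (mul_le_mul_of_nonneg_right hsq2 (norm_nonneg _))
  have hs₁ : Real.sqrt 6 * ((2 * (2 * ((3 : ℝ) * ((F.L : ℝ) ^ (K - n) - 1)) * regThreshold F n K ε₀) + eta F n K / (1 / 12)) / eta F n K) ≤ 31 := by
    -- `regThreshold = ε₀η²`, `(L^k − 1)·η ≤ 1`, so the bond part is `≤ 12ε₀ ≤ 10⁻¹⁷`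
    have hreg_eq : regThreshold F n K ε₀ = ε₀ * eta F n K ^ 2 := regThreshold_eq_mul_eta_sq F ε₀
    have h1 : ((F.L : ℝ) ^ (K - n) - 1) * eta F n K ≤ 1 := by nlinarith [hpow, hη0]
    have h1' : 0 ≤ ((F.L : ℝ) ^ (K - n) - 1) := by linarith [one_le_pow₀ (n := K - n) hL1]
    have hε₀1 : ε₀ ≤ 1 / 10 ^ 18 := by
      have hL3 : (1 : ℝ) ≤ (F.L : ℝ) ^ 3 := one_le_pow₀ hL1
      nlinarith
    have hfrac : (2 * (2 * ((3 : ℝ) * ((F.L : ℝ) ^ (K - n) - 1)) * regThreshold F n K ε₀) + eta F n K / (1 / 12)) / eta F n K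
        = 12 * (((F.L : ℝ) ^ (K - n) - 1) * eta F n K) * ε₀ + 12 := by
      rw [hreg_eq]; field_simp; ring
    rw [hfrac]
    have h2 : 12 * (((F.L : ℝ) ^ (K - n) - 1) * eta F n K) * ε₀ + 12 ≤ 62 / 5 := by
      have : ((F.L : ℝ) ^ (K - n) - 1) * eta F n K * ε₀ ≤ 1 * (1 / 10 ^ 18) :=
        mul_le_mul h1 hε₀1 hε₀.le zero_le_one
      linarith
    calc Real.sqrt 6 * (12 * (((F.L : ℝ) ^ (K - n) - 1) * eta F n K) * ε₀ + 12) ≤ (5 / 2) * (62 / 5) :=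
          mul_le_mul hsq6 h2 (by positivity) (by norm_num)
      _ = 31 := by norm_num
  have HS1 : ∀ c, ‖DL2 F n K c₀ U₀ (toL2S F K c₀ (S c))‖ ≤ 31 * q c := fun c =>
    (hS1 c).trans (mul_le_mul_of_nonneg_right hs₁ (norm_nonneg _))
  -- the `q`-size of a coarse field through its pointwise operator norms
  have hq_le_of_pointwise : ∀ (m c : Site (F.P K) (K - n) → Matrix (Fin 2) (Fin 2) ℂ) (a : ℝ), 0 ≤ a → (∀ y, ‖m y‖ ≤ a * ‖c y‖) →
      q m ≤ Real.sqrt 2 * a * q c := by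
    intro m c a ha hm
    have hc0 : 0 < c₀ := Fact.out
    rw [hq_eq m, hq_eq c]
    have hF : ∀ y, ∑ j : Fin 2, ∑ k : Fin 2, ‖m y j k‖ ^ 2 ≤ 2 * (a * ‖c y‖) ^ 2 := fun y => by
      have h1 := sum_norm_sq_le_mul_opNorm_sq (N := 2) (m y)
      have h2 : ‖m y‖ ^ 2 ≤ (a * ‖c y‖) ^ 2 := pow_le_pow_left₀ (norm_nonneg _) (hm y) 2
      calc ∑ j : Fin 2, ∑ k : Fin 2, ‖m y j k‖ ^ 2 ≤ 2 * ‖m y‖ ^ 2 := by simpa using h1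
        _ ≤ 2 * (a * ‖c y‖) ^ 2 := by linarith
    have hop : ∀ y, ‖c y‖ ^ 2 ≤ ∑ j : Fin 2, ∑ k : Fin 2, ‖c y j k‖ ^ 2 := fun y => MatrixNorms.opNorm_sq_le_sum_norm_sq (c y)
    have hsum : c₀ * (eta F n K)⁻¹ ^ 3 * ∑ y : Site (F.P K) (K - n), ∑ j : Fin 2, ∑ k : Fin 2, ‖m y j k‖ ^ 2
        ≤ (Real.sqrt 2 * a) ^ 2 * (c₀ * (eta F n K)⁻¹ ^ 3 * ∑ y : Site (F.P K) (K - n), ∑ j : Fin 2, ∑ k : Fin 2, ‖c y j k‖ ^ 2) := by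
      rw [mul_pow, Real.sq_sqrt (by norm_num : (0:ℝ) ≤ 2)]
      have hw0 : 0 ≤ c₀ * (eta F n K)⁻¹ ^ 3 := by positivity
      calc c₀ * (eta F n K)⁻¹ ^ 3 * ∑ y : Site (F.P K) (K - n), ∑ j : Fin 2, ∑ k : Fin 2, ‖m y j k‖ ^ 2
          ≤ c₀ * (eta F n K)⁻¹ ^ 3 * ∑ y : Site (F.P K) (K - n), 2 * (a * ‖c y‖) ^ 2 :=
            mul_le_mul_of_nonneg_left (Finset.sum_le_sum fun y _ => hF y) hw0
        _ = 2 * a ^ 2 * (c₀ * (eta F n K)⁻¹ ^ 3 * ∑ y : Site (F.P K) (K - n), ‖c y‖ ^ 2) := by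
            rw [Finset.mul_sum, Finset.mul_sum, Finset.mul_sum]; refine Finset.sum_congr rfl fun y _ => ?_; ring
        _ ≤ 2 * a ^ 2 * (c₀ * (eta F n K)⁻¹ ^ 3 * ∑ y : Site (F.P K) (K - n), ∑ j : Fin 2, ∑ k : Fin 2, ‖c y j k‖ ^ 2) := by
            refine mul_le_mul_of_nonneg_left (mul_le_mul_of_nonneg_left (Finset.sum_le_sum fun y _ => hop y) hw0) (by positivity)
    calc Real.sqrt (c₀ * (eta F n K)⁻¹ ^ 3 * ∑ y : Site (F.P K) (K - n), ∑ j : Fin 2, ∑ k : Fin 2, ‖m y j k‖ ^ 2)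
        ≤ Real.sqrt ((Real.sqrt 2 * a) ^ 2 * (c₀ * (eta F n K)⁻¹ ^ 3 * ∑ y : Site (F.P K) (K - n), ∑ j : Fin 2, ∑ k : Fin 2, ‖c y j k‖ ^ 2)) :=
          Real.sqrt_le_sqrt hsum
      _ = Real.sqrt 2 * a * Real.sqrt (c₀ * (eta F n K)⁻¹ ^ 3 * ∑ y : Site (F.P K) (K - n), ∑ j : Fin 2, ∑ k : Fin 2, ‖c y j k‖ ^ 2) := by
          rw [Real.sqrt_mul (sq_nonneg _), Real.sqrt_sq (by positivity)]
  -- the `q`-size of `Kop N − ns_{K−n}` ((d1), ★px6) and of `ns_{K−n}` (boundedness, ★px6), for any averaging sequence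
  have hd1 : ∀ (N : Site (F.P K) 0 → Matrix (Fin 2) (Fin 2) ℂ) (ns : (j : ℕ) → Site (F.P K) j → Matrix (Fin 2) (Fin 2) ℂ), ns 0 = N →
      (∀ (j : ℕ) (y : Site (F.P K) (j + 1)), ns (j + 1) y = ns j (emb y) - meanCLM (Idx (F.P K)) (Matrix (Fin 2) (Fin 2) ℂ) fun i : Idx (F.P K) =>
          ns j (emb y) - ((holT (emlIterU j (bgUnits F K U₀)) (emb y) (stairWord i.2.1 (off i.1)) : (Matrix (Fin 2) (Fin 2) ℂ)ˣ) : Matrix (Fin 2) (Fin 2) ℂ) *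
            ns j (transl (emb y) (disp (stairWord i.2.1 (off i.1)))) * (((holT (emlIterU j (bgUnits F K U₀)) (emb y) (stairWord i.2.1 (off i.1)))⁻¹ : (Matrix (Fin 2) (Fin 2) ℂ)ˣ) : Matrix (Fin 2) (Fin 2) ℂ)) →
      q (Kop N - ns (K - n)) ≤ Real.sqrt 2 * (3 / 10 ^ 10) * ‖toL2S F K c₀ N‖ ∧ q (ns (K - n)) ≤ Real.sqrt 2 * ‖toL2S F K c₀ N‖ := by
    intro N ns h0 hsucc
    have h1 := (crs_frameResponse_sub_avgSeq_le_of_plaqSmall F hε₀ he hWe hWε hε₀' hε' U₀ U' hreg hplaq' A₁ hA₁ hU' (hg0 N) (hgd N) ns h0 hsucc (hV N) hδT (c₀ := c₀)).2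
    have h2 := (crs_avgSeq_le_of_regPr F hε₀ hε7 U₀ hreg ns h0 hsucc (c₀ := c₀)).2
    refine ⟨?_, ?_⟩
    · rw [hq_eq]
      have hfun : ∀ y j k, (Kop N - ns (K - n)) y j k = ((N (embIter (K - n) y) - V N y * (((frameAccU (K - n) (bgUnits F K U₀) (bgUnits F K U') y)⁻¹ :
          (Matrix (Fin 2) (Fin 2) ℂ)ˣ) : Matrix (Fin 2) (Fin 2) ℂ)) - ns (K - n) y) j k := fun y j k => by rw [Pi.sub_apply, hKop]
      simp_rw [hfun]
      exact h1
    · rw [hq_eq]; exact h2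
  -- boundedness `q(𝓚 g) ≤ √2(1 + 3/10⁶)·‖toL2S g‖`
  have HK : ∀ g : Site (F.P K) 0 → Matrix (Fin 2) (Fin 2) ℂ, q (Kop g) ≤ Real.sqrt 2 * (1 + 3 / 10 ^ 10) * ‖toL2S F K c₀ g‖ := by
    intro g
    obtain ⟨ns, h0, hsucc⟩ := exists_avgSeq (fun j (y : Site (F.P K) (j + 1)) (i : Idx (F.P K)) => holT (emlIterU j (bgUnits F K U₀)) (emb y) (stairWord i.2.1 (off i.1))) g
    obtain ⟨ha, hb⟩ := hd1 g ns h0 hsucc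
    have hsplit : Kop g = (Kop g - ns (K - n)) + ns (K - n) := by abel
    calc q (Kop g) = q ((Kop g - ns (K - n)) + ns (K - n)) := by rw [← hsplit]
      _ ≤ q (Kop g - ns (K - n)) + q (ns (K - n)) := hq_add _ _
      _ ≤ Real.sqrt 2 * (3 / 10 ^ 10) * ‖toL2S F K c₀ g‖ + Real.sqrt 2 * ‖toL2S F K c₀ g‖ := add_le_add ha hb
      _ = Real.sqrt 2 * (1 + 3 / 10 ^ 10) * ‖toL2S F K c₀ g‖ := by ring
  -- approximate identity `q(𝓚(S c) − κ•c) ≤ θ₀κ·q c`, `θ₀κ := 27/4/10⁶ + (3/2)·4500L²ε₀·κ` ((d1) ★px6 + (d2) ★px11∕★px20 + (ii),(iii) ★px10)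
  have HAPP : ∀ c : Site (F.P K) (K - n) → Matrix (Fin 2) (Fin 2) ℂ,
      q (Kop (S c) - ((κ : ℝ) : ℂ) • c) ≤ ((27 / 4 / 10 ^ 10 + (3 / 2) * (4500 * (F.L : ℝ) ^ 2 * ε₀) * κ) / κ) * κ * q c := by
    intro c
    obtain ⟨ns, h0, hsucc⟩ := exists_avgSeq (fun j (y : Site (F.P K) (j + 1)) (i : Idx (F.P K)) => holT (emlIterU j (bgUnits F K U₀)) (emb y) (stairWord i.2.1 (off i.1))) (S c)
    obtain ⟨ha, -⟩ := hd1 (S c) ns h0 hsucc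
    -- (d2) pointwise: nested mean vs `κ • c y`
    have hd2 : ∀ y : Site (F.P K) (K - n), ‖(ns (K - n) - ((κ : ℝ) : ℂ) • c) y‖ ≤ (4500 * (F.L : ℝ) ^ 2 * ε₀ * κ) * ‖c y‖ := fun y => by
      have h1 := norm_ns_sub_refMean_le_of_plaqSmall F hε₀ hε7 U₀ hreg.1 ns (S c) h0 hsucc (K - n) le_rfl y
      rw [hii c y] at h1
      rw [Pi.sub_apply, Pi.smul_apply, Complex.coe_smul]
      calc ‖ns (K - n) y - κ • c y‖ ≤ (4500 * (F.L : ℝ) ^ 2 * ε₀) * ((((((F.P K).L : ℝ) ^ (F.P K).d) ^ (K - n))⁻¹) * ∑ x ∈ iterBlock (K - n) y, ‖S c x‖) := h1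
        _ = (4500 * (F.L : ℝ) ^ 2 * ε₀ * κ) * ‖c y‖ := by
            rw [hiii c y]
            have hLd : ((((F.P K).L : ℝ) ^ (F.P K).d) ^ (K - n)) ≠ 0 := pow_ne_zero _ (pow_ne_zero _ (by exact_mod_cast (F.P K).L_pos.ne'))
            field_simp
    have hB : q (ns (K - n) - ((κ : ℝ) : ℂ) • c) ≤ Real.sqrt 2 * (4500 * (F.L : ℝ) ^ 2 * ε₀ * κ) * q c :=
      hq_le_of_pointwise _ c _ (by positivity) hd2
    have hsplit : Kop (S c) - ((κ : ℝ) : ℂ) • c = (Kop (S c) - ns (K - n)) + (ns (K - n) - ((κ : ℝ) : ℂ) • c) := by abel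
    have hs2 : Real.sqrt 2 ≤ 3 / 2 := hsq2
    have hq0 : 0 ≤ q c := hq_nonneg c
    have hLε : 0 ≤ 4500 * (F.L : ℝ) ^ 2 * ε₀ * κ := by positivity
    calc q (Kop (S c) - ((κ : ℝ) : ℂ) • c) = q ((Kop (S c) - ns (K - n)) + (ns (K - n) - ((κ : ℝ) : ℂ) • c)) := by rw [← hsplit]
      _ ≤ q (Kop (S c) - ns (K - n)) + q (ns (K - n) - ((κ : ℝ) : ℂ) • c) := hq_add _ _
      _ ≤ Real.sqrt 2 * (3 / 10 ^ 10) * ‖toL2S F K c₀ (S c)‖ + Real.sqrt 2 * (4500 * (F.L : ℝ) ^ 2 * ε₀ * κ) * q c := add_le_add ha hB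
      _ ≤ (3 / 2) * (3 / 10 ^ 10) * ((3 / 2) * q c) + (3 / 2) * (4500 * (F.L : ℝ) ^ 2 * ε₀ * κ) * q c := by
          gcongr
          exact HS0 c
      _ = ((27 / 4 / 10 ^ 10 + (3 / 2) * (4500 * (F.L : ℝ) ^ 2 * ε₀) * κ) / κ) * κ * q c := by field_simp; ring
  -- the window numerics
  have hθ₀0 : 0 ≤ (27 / 4 / 10 ^ 10 + (3 / 2) * (4500 * (F.L : ℝ) ^ 2 * ε₀) * κ) / κ := by positivity
  have hθ₀' : (27 / 4 / 10 ^ 10 + (3 / 2) * (4500 * (F.L : ℝ) ^ 2 * ε₀) * κ) / κ * κ ≤ 1 / 10 ^ 5 := by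
    rw [div_mul_cancel₀ _ hκ0.ne']
    have hL2ε : (F.L : ℝ) ^ 2 * ε₀ ≤ 1 / 10 ^ 18 := by
      have hL3 : (F.L : ℝ) ^ 2 * ε₀ ≤ (F.L : ℝ) ^ 3 * ε₀ := by
        have : (F.L : ℝ) ^ 2 ≤ (F.L : ℝ) ^ 3 := pow_le_pow_right₀ hL1 (by norm_num)
        exact mul_le_mul_of_nonneg_right this hε₀.le
      nlinarith
    nlinarith
  have hCK0 : 0 ≤ Real.sqrt 2 * (1 + 3 / 10 ^ 10) := by positivity
  have hCK : Real.sqrt 2 * (1 + 3 / 10 ^ 10) ≤ 3 / 2 := by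
    have h14 : Real.sqrt 2 ≤ Real.sqrt ((283 / 200) ^ 2) := Real.sqrt_le_sqrt (by norm_num)
    rw [Real.sqrt_sq (by norm_num)] at h14
    calc Real.sqrt 2 * (1 + 3 / 10 ^ 10) ≤ (283 / 200) * (1 + 3 / 10 ^ 10) := mul_le_mul_of_nonneg_right h14 (by norm_num)
      _ ≤ 3 / 2 := by norm_num
  obtain ⟨hθ, hC₀0, hC₀δ⟩ := window_numerics_all hκlo' hθ₀' hCK
  have hs150 : Real.sqrt ((1 / 524880000 : ℝ) / 2) = 1 / 32400 := by
    rw [show (1 / 524880000 : ℝ) / 2 = (1 / 32400) ^ 2 by norm_num, Real.sqrt_sq (by norm_num)]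
  have hs75 : Real.sqrt (2 * (1 / 524880000 : ℝ)) = 1 / 16200 := by
    rw [show 2 * (1 / 524880000 : ℝ) = (1 / 16200) ^ 2 by norm_num, Real.sqrt_sq (by norm_num)]
  have hθ' : (27 / 4 / 10 ^ 10 + (3 / 2) * (4500 * (F.L : ℝ) ^ 2 * ε₀) * κ) / κ + Real.sqrt 2 * (1 + 3 / 10 ^ 10) * (Real.sqrt ((1 / 524880000 : ℝ) / 2) * 31) / κ < 1 := by
    rw [hs150]; exact hθ
  have HQ4 := hQ4_of_rows F U₀ Kop S q hq_add hq_smul hq_def hκ0 (by norm_num : (0:ℝ) ≤ 3 / 2) (by norm_num : (0:ℝ) ≤ 31) hCK0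
    (by norm_num : (0:ℝ) < 1 / 524880000) HS0 HS1 HK HAPP hθ'
  rw [hs150, hs75] at HQ4
  have hqm : ∀ m, q m = ‖toL2S F n c₁ (fun y' : Site (F.P n) 0 => m (siteShift (sites_eq F n K h) y'))‖ := fun m => rfl
  refine ⟨Kop, (3 / 2 + 31 + 31 / (1 / 16200 : ℝ)) / (κ * (1 - ((27 / 4 / 10 ^ 10 + (3 / 2) * (4500 * (F.L : ℝ) ^ 2 * ε₀) * κ) / κ +
      Real.sqrt 2 * (1 + 3 / 10 ^ 10) * ((1 / 32400 : ℝ) * 31) / κ))), Real.sqrt 2 * (3 / 10 ^ 10), hC₀0, by positivity, hC₀δ, HT, fun m => ?_, HKT⟩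
  obtain ⟨N, hN, r0, r1, r2⟩ := HQ4 m
  rw [hqm] at r0 r1 r2
  exact ⟨N, hN, r0, r1, r2⟩

end Summit.QuantumFields.YangMills.Theorems.Prop7LandauTransversalityRowsY1All

end
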